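import Literature.Analysis.FluidPDE.AxisymmetricEuler
import Summits.NavierStokesRegularity.NavierStokesRegularity.Theorems.ScenarioCensusPeriodicSlabTools
import Mathlib.MeasureTheory.Integral.Prod
import Mathlib.MeasureTheory.Integral.IntervalIntegral.Periodic
import Mathlib.MeasureTheory.Integral.DominatedConvergence
import Mathlib.MeasureTheory.Group.Measure
import HarnessLib

/-!
# Route `ExtremiserTransience`, crux `NearExtremalTransiencePerFlow` (stmt-NavierStokesRegularity-26567), rung R1
# `PeriodicFilamentLiouville` of LINE g9-β `filament_selection` — TOOLS I: axially periodic functions on `ℝ³`,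
# period windows, and the vanishing of period-window integrals of functions with zero axial mean

Theorems file (`--supports stmt-NavierStokesRegularity-26567`; theorems only, no definitions).  For a function `φ` on
`ℝ³` which is `ℓ`-periodic in the axial variable (the tree's `IsAxiallyPeriodic ℓ φ`: `φ (x + ℓ e_z) = φ x`):

* axial lines are periodic (`isAxiallyPeriodic_periodic_line`), so axial line integrals over one period do not
  depend on the base point of the period nor on the orientation (`intervalIntegral_comp_sub_smul_eZ_of_isAxiallyPeriodic`);
* PERIOD WINDOWS `{y | a ≤ y₂ < b}`: the integral of a periodic integrand over a window of exactly one period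
  does not depend on the position of the window (`setIntegral_window_shift`; translation
  invariance of Lebesgue measure, as in the slab technique of `PeriodicWindowIntegral` — no product decomposition
  `ℝ³ = ℝ² × ℝ` is used);
* ZERO AXIAL MEAN (`∫₀^ℓ φ (y + s e_z) ds = 0` for every `y`) implies `∫_{a ≤ y₂ < a+ℓ} g(y) φ(y) dy = 0` for
  every continuous axially invariant weight `g` integrable on windows
  (`setIntegral_window_smul_eq_zero_of_axialMean_zero`: the translated integrals `∫ g(y) φ(y + σ e_z) dy` are
  all equal, and their average over `σ ∈ [0, ℓ]` vanishes by Fubini over `ℝ³ × [0, ℓ]`);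
* parametric continuity of line integrals (`continuous_intervalIntegral_comp_add_smul`,
  `continuousOn_intervalIntegral_comp_add_smul`).

Companion: `ExtremiserTransienceAxialMeanZeroHeatContraction` (the strict `L^∞` contraction of the heat flow on such data).
Everything is elementary measure theory; nothing here concerns Navier–Stokes; no summit is proved by a line. [folklore]

## Mathlib / tree search

Tree: `eZ`, `cylRadius`, `cylRadius_sq`, `IsAxiallyPeriodic` (`AxisymmetricEuler`); `PeriodicWindowIntegral`
(`zSlab`, integer translates; this file needs real translates and vector-valued integrands).  Mathlib:
`Function.Periodic.intervalIntegral_add_eq`, `MeasurePreserving.setIntegral_preimage_emb`,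
`measurePreserving_add_right`, `setIntegral_union`, `integral_integral_swap`, `Integrable.mul_prod`,
`intervalIntegral.continuous_parametric_intervalIntegral_of_continuous'`, `IsOpenEmbedding.continuousAt_iff`,
`ScenarioCensus.PeriodicSlab.apply_two_add_smul_eZ` (tree).
-/

noncomputable section

open MeasureTheory Set Function Filter Metric intervalIntegral Topology
open Literature.Analysis Literature.Analysis.FluidPDE
open scoped RealInnerProductSpace ENNReal

namespace Summit.NavierStokesRegularity.NavierStokesRegularity.Theorems.AxiallyPeriodicLiouville
-- the summit's namespace `Summit.NavierStokesRegularity.NavierStokesRegularity` repeats the problem name by convention (D-0017)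
set_option linter.dupNamespace false

variable {F : Type*} [NormedAddCommGroup F] [NormedSpace ℝ F]

/-! ### Axial translations and period windows -/

/-- The cylindrical radius is invariant under axial translations (squared form). [folklore] -/
theorem cylRadius_sq_add_smul_eZ (x : EuclideanSpace ℝ (Fin 3)) (t : ℝ) :
    cylRadius (x + t • eZ) ^ 2 = cylRadius x ^ 2 := by
  rw [cylRadius_sq, cylRadius_sq]
  simp [eZ]

/-- The period window `{y | a ≤ y₂ < b}` is measurable. [folklore] -/
theorem measurableSet_window (a b : ℝ) : MeasurableSet {y : EuclideanSpace ℝ (Fin 3) | y 2 ∈ Ico a b} := by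
  have hm : Measurable fun y : EuclideanSpace ℝ (Fin 3) => y 2 := by fun_prop
  exact hm measurableSet_Ico

/-- An axially `ℓ`-periodic function is periodic (period `ℓ`) along every axial line. [folklore] -/
theorem isAxiallyPeriodic_periodic_line {α : Type*} {ℓ : ℝ} {φ : EuclideanSpace ℝ (Fin 3) → α}
    (hφ : IsAxiallyPeriodic ℓ φ) (x : EuclideanSpace ℝ (Fin 3)) : Function.Periodic (fun s : ℝ => φ (x + s • eZ)) ℓ := by
  intro s
  have h := hφ (x + s • eZ)
  simp only at h ⊢
  rw [← h, add_smul, eZ, add_assoc]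

/-- Axial periodicity along the negative direction: `φ (x - ℓ e_z) = φ x`. [folklore] -/
theorem isAxiallyPeriodic_sub_period {α : Sort*} {ℓ : ℝ} {φ : EuclideanSpace ℝ (Fin 3) → α}
    (hφ : IsAxiallyPeriodic ℓ φ) (x : EuclideanSpace ℝ (Fin 3)) : φ (x - ℓ • eZ) = φ x := by
  have h := hφ (x - ℓ • eZ)
  rw [eZ] at h ⊢
  rw [sub_add_cancel] at h
  exact h.symm

/-- The axial line integral over one period does not depend on the orientation of the line:
`∫₀^ℓ φ (z − s e_z) ds = ∫₀^ℓ φ (z + s e_z) ds` for axially `ℓ`-periodic `φ`. [folklore] -/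
theorem intervalIntegral_comp_sub_smul_eZ_of_isAxiallyPeriodic {ℓ : ℝ} {φ : EuclideanSpace ℝ (Fin 3) → F}
    (hφ : IsAxiallyPeriodic ℓ φ) (z : EuclideanSpace ℝ (Fin 3)) :
    ∫ s in (0 : ℝ)..ℓ, φ (z - s • eZ) = ∫ s in (0 : ℝ)..ℓ, φ (z + s • eZ) := by
  have h1 : ∫ s in (0 : ℝ)..ℓ, φ (z - s • eZ) = ∫ s in (-ℓ)..(-0 : ℝ), φ (z + s • eZ) := by
    rw [← intervalIntegral.integral_comp_neg (fun s => φ (z + s • eZ))]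
    simp [sub_eq_add_neg]
  rw [h1, neg_zero]
  have h2 := (isAxiallyPeriodic_periodic_line hφ z).intervalIntegral_add_eq (-ℓ) 0
  simp only [neg_add_cancel, zero_add] at h2
  exact h2

/-! ### Window-shift invariance for axially periodic integrands -/

/-- Translating a period window by one period does not change the integral of an axially
`ℓ`-periodic function: `∫_{a+ℓ ≤ y₂ < b+ℓ} G = ∫_{a ≤ y₂ < b} G`. [folklore] -/
theorem setIntegral_window_add_period {ℓ : ℝ} {G : EuclideanSpace ℝ (Fin 3) → F}
    (hG : IsAxiallyPeriodic ℓ G) (a b : ℝ) :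
    ∫ y in {y : EuclideanSpace ℝ (Fin 3) | y 2 ∈ Ico (a + ℓ) (b + ℓ)}, G y =
      ∫ y in {y : EuclideanSpace ℝ (Fin 3) | y 2 ∈ Ico a b}, G y := by
  have hmp : MeasurePreserving (fun y : EuclideanSpace ℝ (Fin 3) => y + ℓ • eZ) volume volume :=
    measurePreserving_add_right volume (ℓ • eZ)
  have hemb : MeasurableEmbedding (fun y : EuclideanSpace ℝ (Fin 3) => y + ℓ • eZ) :=
    (MeasurableEquiv.addRight (ℓ • eZ)).measurableEmbedding
  have hpre : (fun y : EuclideanSpace ℝ (Fin 3) => y + ℓ • eZ) ⁻¹' {y | y 2 ∈ Ico (a + ℓ) (b + ℓ)} =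
      {y | y 2 ∈ Ico a b} := by
    ext y
    simp only [mem_preimage, mem_setOf_eq, ScenarioCensus.PeriodicSlab.apply_two_add_smul_eZ, mem_Ico]
    constructor <;> rintro ⟨h1, h2⟩ <;> constructor <;> linarith
  calc ∫ y in {y : EuclideanSpace ℝ (Fin 3) | y 2 ∈ Ico (a + ℓ) (b + ℓ)}, G y
      = ∫ y in (fun y : EuclideanSpace ℝ (Fin 3) => y + ℓ • eZ) ⁻¹' {y | y 2 ∈ Ico (a + ℓ) (b + ℓ)},
          G (y + ℓ • eZ) := (hmp.setIntegral_preimage_emb hemb G _).symm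
    _ = ∫ y in {y : EuclideanSpace ℝ (Fin 3) | y 2 ∈ Ico a b}, G (y + ℓ • eZ) := by rw [hpre]
    _ = ∫ y in {y : EuclideanSpace ℝ (Fin 3) | y 2 ∈ Ico a b}, G y :=
        setIntegral_congr_fun (measurableSet_window _ _) fun y _ => hG y

/-- **Window-shift invariance.** For an axially `ℓ`-periodic `G` integrable on period windows, the
integral over a window of exactly one period does not depend on the position of the window:
`∫_{a+σ ≤ y₂ < a+σ+ℓ} G = ∫_{a ≤ y₂ < a+ℓ} G` for `0 ≤ σ ≤ ℓ`. [folklore] -/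
theorem setIntegral_window_shift {ℓ : ℝ} {G : EuclideanSpace ℝ (Fin 3) → F}
    (hG : IsAxiallyPeriodic ℓ G) (hGi : ∀ c d : ℝ, IntegrableOn G {y : EuclideanSpace ℝ (Fin 3) | y 2 ∈ Ico c d})
    (a : ℝ) {σ : ℝ} (hσ0 : 0 ≤ σ) (hσℓ : σ ≤ ℓ) :
    ∫ y in {y : EuclideanSpace ℝ (Fin 3) | y 2 ∈ Ico (a + σ) (a + σ + ℓ)}, G y =
      ∫ y in {y : EuclideanSpace ℝ (Fin 3) | y 2 ∈ Ico a (a + ℓ)}, G y := by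
  -- split both windows at `a + σ` resp. `a + ℓ`
  have hsplit : ∀ p q r : ℝ, p ≤ q → q ≤ r →
      ∫ y in {y : EuclideanSpace ℝ (Fin 3) | y 2 ∈ Ico p r}, G y =
        (∫ y in {y : EuclideanSpace ℝ (Fin 3) | y 2 ∈ Ico p q}, G y) +
          ∫ y in {y : EuclideanSpace ℝ (Fin 3) | y 2 ∈ Ico q r}, G y := by
    intro p q r hpq hqr
    have hunion : {y : EuclideanSpace ℝ (Fin 3) | y 2 ∈ Ico p r} =
        {y | y 2 ∈ Ico p q} ∪ {y | y 2 ∈ Ico q r} := by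
      ext y; simp only [mem_setOf_eq, mem_union, ← Ico_union_Ico_eq_Ico hpq hqr]
    have hdisj : Disjoint {y : EuclideanSpace ℝ (Fin 3) | y 2 ∈ Ico p q} {y | y 2 ∈ Ico q r} := by
      rw [Set.disjoint_left]
      intro y hy hy'
      simp only [mem_setOf_eq, mem_Ico] at hy hy'
      linarith [hy.2, hy'.1]
    rw [hunion, setIntegral_union hdisj (measurableSet_window _ _) (hGi _ _) (hGi _ _)]
  rw [hsplit a (a + σ) (a + ℓ) (by linarith) (by linarith),
    hsplit (a + σ) (a + ℓ) (a + σ + ℓ) (by linarith) (by linarith)]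
  have hper := setIntegral_window_add_period hG a (a + σ)
  rw [show a + σ + ℓ = (a + σ) + ℓ by ring, hper, add_comm]

/-! ### A periodic function with zero axial mean integrates to zero over every period window
against an axially invariant weight -/

/-- Integrability of `g • φ` on period windows from integrability of the weight `g` and boundedness of
`φ`. [folklore] -/
theorem integrableOn_window_smul_of_bound {g : EuclideanSpace ℝ (Fin 3) → ℝ}
    (hgi : ∀ c d : ℝ, IntegrableOn g {y : EuclideanSpace ℝ (Fin 3) | y 2 ∈ Ico c d})
    {φ : EuclideanSpace ℝ (Fin 3) → F} (hφ : Continuous φ) {B : ℝ} (hB : ∀ y, ‖φ y‖ ≤ B) (c d : ℝ) :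
    IntegrableOn (fun y => g y • φ y) {y : EuclideanSpace ℝ (Fin 3) | y 2 ∈ Ico c d} := by
  have h1 : IntegrableOn (fun y => ‖g y‖ * B) {y : EuclideanSpace ℝ (Fin 3) | y 2 ∈ Ico c d} :=
    (hgi c d).norm.mul_const B
  refine Integrable.mono' h1 ((hgi c d).aestronglyMeasurable.smul hφ.aestronglyMeasurable.restrict) ?_
  refine Eventually.of_forall fun y => ?_
  rw [norm_smul]
  exact mul_le_mul_of_nonneg_left (hB y) (norm_nonneg _)

/-- **Zero axial mean ⇒ zero integral over every period window against an axially invariant weight.**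
Let `φ : ℝ³ → F` be continuous, bounded, axially `ℓ`-periodic with `∫₀^ℓ φ (y + s e_z) ds = 0` for every `y`,
and let `g : ℝ³ → ℝ` be a continuous weight, invariant under all axial translations and integrable on period
windows.  Then `∫_{a ≤ y₂ < a+ℓ} g(y) φ(y) dy = 0` for every `a`.  Proof: the translated integrals
`J(σ) = ∫_{window} g(y) φ(y + σ e_z) dy` are all equal to `J(0)` (translation invariance of Lebesgue measure
and window-shift invariance), and their average over `σ ∈ [0, ℓ]` vanishes by Fubini. [folklore] -/
theorem setIntegral_window_smul_eq_zero_of_axialMean_zero [CompleteSpace F] {ℓ : ℝ} (hℓ : 0 < ℓ)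
    {g : EuclideanSpace ℝ (Fin 3) → ℝ} (hg : Continuous g) (hginv : ∀ (y : EuclideanSpace ℝ (Fin 3)) (s : ℝ), g (y + s • eZ) = g y)
    (hgi : ∀ c d : ℝ, IntegrableOn g {y : EuclideanSpace ℝ (Fin 3) | y 2 ∈ Ico c d})
    {φ : EuclideanSpace ℝ (Fin 3) → F} (hφ : Continuous φ) {B : ℝ} (hB : ∀ y, ‖φ y‖ ≤ B)
    (hper : IsAxiallyPeriodic ℓ φ) (hmean : ∀ y, ∫ s in (0 : ℝ)..ℓ, φ (y + s • eZ) = 0) (a : ℝ) :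
    ∫ y in {y : EuclideanSpace ℝ (Fin 3) | y 2 ∈ Ico a (a + ℓ)}, g y • φ y = 0 := by
  set W : Set (EuclideanSpace ℝ (Fin 3)) := {y | y 2 ∈ Ico a (a + ℓ)} with hW
  have hWm : MeasurableSet W := measurableSet_window _ _
  -- `g • φ` is periodic and integrable on windows
  have hGper : IsAxiallyPeriodic ℓ (fun y => g y • φ y) := by
    intro y
    have h1 : g (y + ℓ • eZ) = g y := hginv y ℓ
    have h2 : φ (y + ℓ • eZ) = φ y := hper y
    simp only [eZ] at h1 h2
    simp only [h1, h2]
  have hGi : ∀ c d : ℝ, IntegrableOn (fun y => g y • φ y) {y : EuclideanSpace ℝ (Fin 3) | y 2 ∈ Ico c d} :=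
    integrableOn_window_smul_of_bound hgi hφ hB
  -- the translated integrals are all equal
  have hJ : ∀ σ ∈ Icc (0 : ℝ) ℓ, ∫ y in W, g y • φ (y + σ • eZ) = ∫ y in W, g y • φ y := by
    intro σ hσ
    have hmp : MeasurePreserving (fun y : EuclideanSpace ℝ (Fin 3) => y + σ • eZ) volume volume :=
      measurePreserving_add_right volume (σ • eZ)
    have hemb : MeasurableEmbedding (fun y : EuclideanSpace ℝ (Fin 3) => y + σ • eZ) :=
      (MeasurableEquiv.addRight (σ • eZ)).measurableEmbedding
    have hpre : (fun y : EuclideanSpace ℝ (Fin 3) => y + σ • eZ) ⁻¹' {y | y 2 ∈ Ico (a + σ) (a + σ + ℓ)} = W := by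
      ext y
      simp only [hW, mem_preimage, mem_setOf_eq, ScenarioCensus.PeriodicSlab.apply_two_add_smul_eZ, mem_Ico]
      constructor <;> rintro ⟨h1, h2⟩ <;> constructor <;> linarith
    calc ∫ y in W, g y • φ (y + σ • eZ)
        = ∫ y in W, (fun z => g z • φ z) (y + σ • eZ) := by
          refine setIntegral_congr_fun hWm fun y _ => ?_
          simp only [hginv y σ]
      _ = ∫ y in (fun y : EuclideanSpace ℝ (Fin 3) => y + σ • eZ) ⁻¹' {y | y 2 ∈ Ico (a + σ) (a + σ + ℓ)},
            (fun z => g z • φ z) (y + σ • eZ) := by rw [hpre]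
      _ = ∫ z in {y : EuclideanSpace ℝ (Fin 3) | y 2 ∈ Ico (a + σ) (a + σ + ℓ)}, g z • φ z :=
          hmp.setIntegral_preimage_emb hemb (fun z => g z • φ z) _
      _ = ∫ z in W, g z • φ z := setIntegral_window_shift hGper hGi a hσ.1 hσ.2
  -- hence their average over one period is `ℓ • J(0)` …
  have hconst : ∫ σ in (0 : ℝ)..ℓ, (∫ y in W, g y • φ (y + σ • eZ)) = ℓ • ∫ y in W, g y • φ y := by
    have hcongr : ∫ σ in (0 : ℝ)..ℓ, (∫ y in W, g y • φ (y + σ • eZ)) =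
        ∫ σ in (0 : ℝ)..ℓ, (∫ y in W, g y • φ y) := by
      refine intervalIntegral.integral_congr fun σ hσ => ?_
      rw [uIcc_of_le hℓ.le] at hσ
      exact hJ σ hσ
    rw [hcongr, intervalIntegral.integral_const, sub_zero]
  -- … and `0` by Fubini and the zero axial mean
  have hswap : ∫ σ in (0 : ℝ)..ℓ, (∫ y in W, g y • φ (y + σ • eZ)) =
      ∫ y in W, g y • ∫ σ in (0 : ℝ)..ℓ, φ (y + σ • eZ) := by
    rw [intervalIntegral.integral_of_le hℓ.le]
    haveI : IsFiniteMeasure ((volume : Measure ℝ).restrict (Ioc (0 : ℝ) ℓ)) :=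
      isFiniteMeasure_restrict.2 measure_Ioc_lt_top.ne
    have hdom : Integrable (fun p : ℝ × EuclideanSpace ℝ (Fin 3) => (1 : ℝ) * (‖g p.2‖ * B))
        (((volume : Measure ℝ).restrict (Ioc (0 : ℝ) ℓ)).prod (volume.restrict W)) :=
      Integrable.mul_prod (integrable_const (1 : ℝ)) ((hgi a (a + ℓ)).norm.mul_const B)
    have hint : Integrable (uncurry fun (σ : ℝ) (y : EuclideanSpace ℝ (Fin 3)) => g y • φ (y + σ • eZ))
        (((volume : Measure ℝ).restrict (Ioc (0 : ℝ) ℓ)).prod (volume.restrict W)) := by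
      refine hdom.mono' ?_ (Eventually.of_forall fun p => ?_)
      · have hc : Continuous (uncurry fun (σ : ℝ) (y : EuclideanSpace ℝ (Fin 3)) => g y • φ (y + σ • eZ)) := by
          have h1 : Continuous fun p : ℝ × EuclideanSpace ℝ (Fin 3) => p.2 + p.1 • eZ := by fun_prop
          exact (hg.comp continuous_snd).smul (hφ.comp h1)
        exact hc.aestronglyMeasurable
      · simp only [uncurry, norm_smul, one_mul]
        exact mul_le_mul_of_nonneg_left (hB _) (norm_nonneg _)
    rw [integral_integral_swap hint]
    refine setIntegral_congr_fun hWm fun y _ => ?_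
    rw [MeasureTheory.integral_smul, ← intervalIntegral.integral_of_le hℓ.le]
  have hzero : ℓ • ∫ y in W, g y • φ y = 0 := by
    rw [← hconst, hswap]
    simp only [hmean, smul_zero]
    exact integral_zero _ _
  exact (smul_eq_zero.1 hzero).resolve_left hℓ.ne'

/-! ### Line integrals: continuity, and commutation with the heat flow -/

/-- Parametric continuity of line integrals: `x ↦ ∫ₐᵇ g (x + s v) ds` is continuous for continuous `g`.
[folklore] -/
theorem continuous_intervalIntegral_comp_add_smul {E : Type*} [NormedAddCommGroup E]
    [NormedSpace ℝ E] {g : E → F} (hg : Continuous g) (v : E) (a b : ℝ) :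
    Continuous fun x : E => ∫ s in a..b, g (x + s • v) := by
  have h : Continuous (uncurry fun (x : E) (s : ℝ) => g (x + s • v)) := by
    have h1 : Continuous fun p : E × ℝ => p.1 + p.2 • v := by fun_prop
    exact hg.comp h1
  exact intervalIntegral.continuous_parametric_intervalIntegral_of_continuous' h a b

/-- Joint parametric continuity of line integrals of a jointly continuous family:
`(t, x) ↦ ∫ₐᵇ u t (x + s v) ds` is continuous on `S × univ` whenever `uncurry u` is continuous on `S × univ`
and `S` is open. [folklore] -/
theorem continuousOn_intervalIntegral_comp_add_smul {E : Type*} [NormedAddCommGroup E] [NormedSpace ℝ E]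
    {u : ℝ → E → F} {S : Set ℝ} (hS : IsOpen S) (hu : ContinuousOn (uncurry u) (S ×ˢ univ)) (v : E) (a b : ℝ) :
    ContinuousOn (uncurry fun (t : ℝ) (x : E) => ∫ s in a..b, u t (x + s • v)) (S ×ˢ univ) := by
  have hopen : IsOpen (S ×ˢ (univ : Set E)) := hS.prod isOpen_univ
  refine continuousOn_of_forall_continuousAt fun p hp => ?_
  -- restrict to the open subtype and use parametric continuity there
  have hsub : Continuous fun q : ↥(S ×ˢ (univ : Set E)) × ℝ => u q.1.1.1 (q.1.1.2 + q.2 • v) := by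
    have h1 : Continuous fun q : ↥(S ×ˢ (univ : Set E)) × ℝ => ((q.1.1.1, q.1.1.2 + q.2 • v) : ℝ × E) := by
      fun_prop
    have h2 : ∀ q : ↥(S ×ˢ (univ : Set E)) × ℝ, ((q.1.1.1, q.1.1.2 + q.2 • v) : ℝ × E) ∈ S ×ˢ univ :=
      fun q => ⟨q.1.2.1, mem_univ _⟩
    exact hu.comp_continuous h1 h2
  have hcont : Continuous fun q : ↥(S ×ˢ (univ : Set E)) => ∫ s in a..b, u q.1.1 (q.1.2 + s • v) :=
    intervalIntegral.continuous_parametric_intervalIntegral_of_continuous'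
      (f := fun (q : ↥(S ×ˢ (univ : Set E))) (s : ℝ) => u q.1.1 (q.1.2 + s • v)) hsub a b
  have key : ContinuousAt ((uncurry fun (t : ℝ) (x : E) => ∫ s in a..b, u t (x + s • v)) ∘
      (Subtype.val : ↥(S ×ˢ (univ : Set E)) → ℝ × E)) ⟨p, hp⟩ :=
    hcont.continuousAt
  exact (hopen.isOpenEmbedding_subtypeVal.continuousAt_iff).1 key

end Summit.NavierStokesRegularity.NavierStokesRegularity.Theorems.AxiallyPeriodicLiouville

end
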